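import Mathlib
import Summits.Ventures.PercRepro2.BHKEvents
import Summits.Ventures.PercRepro2.VdBKahn
import Summits.Ventures.PercRepro2.OrderPreservation

/-!
# A three-mark one-cluster inequality with two avoided vertices: the residual of the one-bridge
class theorem for (G2) (blind cell PercRepro2, p5 g27; `proofs/P5-OEDGE.md` §35 addendum 1)

For the open cluster `C = C(s)` of a vertex `s` under the product measure and three vertices
`o, v, y` (`O, V, Y` their membership events, `γ = P(Y)`):

  **`0 ≤ tri := (1 − γ)·[P(O ∩ Y ∩ Vᶜ) − γ·P(O ∩ Vᶜ)] + Cov(1_v, 1_y)·P(O ∩ Yᶜ)`**   (`tri_nonneg`).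

In conditional language `tri/(1 − γ) = P(Vᶜ ∩ Yᶜ)·[P(O | Vᶜ) − P(O | Vᶜ ∩ Yᶜ)] + Cov(1_v, 1_y)·[P(O | Yᶜ) − P(O | Vᶜ)]`
— a «three-point» statement that is NOT a consequence of positive association alone (it fails on
some positively associated three-bit laws) but follows from BHK06 Theorem 1.3 with two avoided
vertices: the monotonicity of the cluster in the avoided set (`bhk_avoid_mono_event`,
`X ⊆ X′ ⟹ P(O, s ↮ X′)·P(s ↮ X) ≤ P(O, s ↮ X)·P(s ↮ X′)`) at `X = {v} ⊆ {v, y}` and at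
`X = {y} ⊆ {v, y}`, Harris for `Cov(1_v, 1_y) ≥ 0`, and the two exact identities

  `tri = Δ′·P(Yᶜ) + [P(Vᶜ∩Yᶜ)·P(O∩Yᶜ) − P(O∩Vᶜ∩Yᶜ)·P(Yᶜ)]`,   `Δ′ := P(O∩Vᶜ)·P(Yᶜ) − P(O∩Yᶜ)·P(Vᶜ)`,
  `tri·P(Vᶜ) = P(Yᶜ)·[P(Vᶜ∩Yᶜ)·P(O∩Vᶜ) − P(O∩Vᶜ∩Yᶜ)·P(Vᶜ)] − Cov(1_v, 1_y)·Δ′`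

(`tri_eq_case_pos`, `tri_mul_eq_case_neg`): the first settles `Δ′ ≥ 0`, the second `Δ′ < 0` (there
`P(Vᶜ) > 0` is forced).  Both identities were checked exactly on random instances before the proof.

Why it is here (paper, not formalised): in the one-bridge family of §35 (`a₁, b` on one side,
`a₂, o, v` on the other, one bridge `(x, y)` of probability `t`, `α = P_A(x ↔ a₁)`,
`κ = Cov_A(1_b, 1_x)`) the cleared (G2) is exactly `t·κ·(T − t·α·W)` and `T − W ≥ tri(a₂; o, v, y) + (masses ≥ 0)`;
with `T ≥ 0` (`ClusterThreePoint`) this gives (G2) on the whole one-bridge family — the mirror half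
reduces to two further one-cluster inequalities proved in the same addendum.  Nothing here claims (G2).
-/

namespace Summit.Ventures.PercRepro2

namespace ClusterThreeMark

variable {V : Type*} {E : Type*} [Fintype E] [DecidableEq E] [Fintype V] [DecidableEq V]
  {R : Type*} [Field R] [LinearOrder R] [IsStrictOrderedRing R]

variable (p : E → R) (ends : E → Sym2 V)

/-! ## BHK06 Theorem 1.3 with two avoided sets: the cluster shrinks with the avoided set -/

/-- **Monotonicity of the cluster in the avoided set** (BHK06 Thm 1.3 with `F₂ = 1`, `X ⊆ X′`):
`P(o ∈ C_s, s ↮ X′)·P(s ↮ X) ≤ P(o ∈ C_s, s ↮ X)·P(s ↮ X′)`, i.e. `P(o ∈ C_s | s ↮ X′) ≤ P(o ∈ C_s | s ↮ X)`. -/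
theorem bhk_avoid_mono_event (hp : IsProbVec p) (s o : V) {X X' : Finset V} (h : X ⊆ X') :
    prob p (connEvent ends s o ∩ avoidAll ends s X') * prob p (avoidAll ends s X) ≤
      prob p (connEvent ends s o ∩ avoidAll ends s X) * prob p (avoidAll ends s X') := by
  classical
  set F₁ : Set V → R := ({S : Set V | o ∈ S}).indicator 1 with hF₁
  set F₂ : Set V → R := fun _ => (1 : R) with hF₂
  have key := bhk_induced p hp ends s (F₁ := F₁) (F₂ := F₂)
    (monotone_indicator_one_of_isUpperSet (R := R) (isUpperSet_mem_setOf o))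
    (fun _ _ _ => le_refl _) (fun _ => Set.indicator_apply_nonneg fun _ => zero_le_one)
    (fun _ => zero_le_one) Finset.univ X' X (Finset.subset_univ _) (Finset.subset_univ _)
  rw [Finset.inter_eq_right.2 h, Finset.union_eq_left.2 h, REvent_univ, REvent_univ] at key
  have e : ∀ (F : Set V → R) (A : Set (Config E)),
      clusterObs ends Finset.univ s F * A.indicator 1 =
        fun ω => F (cluster ends ω s) * A.indicator 1 ω := by
    intro F A
    funext ω
    simp only [Pi.mul_apply, clusterObs_apply, clusterIn_univ]
  rw [e, e, e] at key
  have h1 : expect p (fun ω => F₁ (cluster ends ω s) * (avoidAll ends s X').indicator 1 ω) =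
      prob p (connEvent ends s o ∩ avoidAll ends s X') := by
    rw [connEvent_eq_clusterInEvent, prob_clusterInEvent_inter_eq_expect]
  have h2 : expect p (fun ω => F₂ (cluster ends ω s) * (avoidAll ends s X).indicator 1 ω) =
      prob p (avoidAll ends s X) := by
    rw [prob_eq_expect_indicator]
    congr 1
    funext ω
    simp [hF₂]
  have h3 : expect p (fun ω => (F₁ * F₂) (cluster ends ω s) * (avoidAll ends s X).indicator 1 ω) =
      prob p (connEvent ends s o ∩ avoidAll ends s X) := by
    rw [connEvent_eq_clusterInEvent, prob_clusterInEvent_inter_eq_expect]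
    congr 1
    funext ω
    simp [hF₂, hF₁]
  rw [h1, h2, h3] at key
  exact key

omit [Fintype E] [DecidableEq E] [Fintype V] [DecidableEq V] in
/-- `s ↮ {x}` is the complement of `{s ↔ x}`. -/
lemma avoidAll_singleton_eq (s x : V) : avoidAll ends s {x} = (connEvent ends s x)ᶜ := by
  ext ω
  simp only [avoidAll, Set.mem_setOf_eq, Finset.mem_singleton, forall_eq, Set.mem_compl_iff,
    mem_connEvent]

omit [Fintype E] [DecidableEq E] [Fintype V] in
/-- `s ↮ {v, y}` is the intersection of the two complements. -/
lemma avoidAll_pair_eq (s v y : V) :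
    avoidAll ends s {v, y} = (connEvent ends s v)ᶜ ∩ (connEvent ends s y)ᶜ := by
  ext ω
  simp only [avoidAll, Set.mem_setOf_eq, Finset.mem_insert, Finset.mem_singleton, Set.mem_inter_iff,
    Set.mem_compl_iff, mem_connEvent]
  constructor
  · intro h
    exact ⟨h v (Or.inl rfl), h y (Or.inr rfl)⟩
  · rintro ⟨hv, hy⟩ x hx
    rcases hx with rfl | rfl
    · exact hv
    · exact hy

/-- **The two instances used**: with `X = {v} ⊆ {v, y}`,
`P(O ∩ Vᶜ ∩ Yᶜ)·P(Vᶜ) ≤ P(O ∩ Vᶜ)·P(Vᶜ ∩ Yᶜ)`. -/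
theorem avoid_mono_v (hp : IsProbVec p) (s o v y : V) :
    prob p (connEvent ends s o ∩ ((connEvent ends s v)ᶜ ∩ (connEvent ends s y)ᶜ)) *
        prob p (connEvent ends s v)ᶜ ≤
      prob p (connEvent ends s o ∩ (connEvent ends s v)ᶜ) *
        prob p ((connEvent ends s v)ᶜ ∩ (connEvent ends s y)ᶜ) := by
  have h := bhk_avoid_mono_event p ends hp s o (X := {v}) (X' := {v, y})
    (Finset.singleton_subset_iff.2 (Finset.mem_insert_self v {y}))
  rwa [avoidAll_singleton_eq, avoidAll_pair_eq] at h

/-- With `X = {y} ⊆ {v, y}`: `P(O ∩ Vᶜ ∩ Yᶜ)·P(Yᶜ) ≤ P(O ∩ Yᶜ)·P(Vᶜ ∩ Yᶜ)`. -/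
theorem avoid_mono_y (hp : IsProbVec p) (s o v y : V) :
    prob p (connEvent ends s o ∩ ((connEvent ends s v)ᶜ ∩ (connEvent ends s y)ᶜ)) *
        prob p (connEvent ends s y)ᶜ ≤
      prob p (connEvent ends s o ∩ (connEvent ends s y)ᶜ) *
        prob p ((connEvent ends s v)ᶜ ∩ (connEvent ends s y)ᶜ) := by
  have h := bhk_avoid_mono_event p ends hp s o (X := {y}) (X' := {v, y})
    (Finset.singleton_subset_iff.2 (Finset.mem_insert_of_mem (Finset.mem_singleton_self y)))
  rwa [avoidAll_singleton_eq, avoidAll_pair_eq] at h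

/-! ## The three-mark quantity and its sign -/

/-- **The cleared three-mark quantity** `tri(s; o, v, y)`:
`(1 − P(Y))·[P(O ∩ Y ∩ Vᶜ) − P(Y)·P(O ∩ Vᶜ)] + [P(V ∩ Y) − P(V)·P(Y)]·P(O ∩ Yᶜ)`. -/
noncomputable def tri (s o v y : V) : R :=
  (1 - prob p (connEvent ends s y)) *
      (prob p (connEvent ends s o ∩ connEvent ends s y ∩ (connEvent ends s v)ᶜ) -
        prob p (connEvent ends s y) * prob p (connEvent ends s o ∩ (connEvent ends s v)ᶜ)) +
    (prob p (connEvent ends s v ∩ connEvent ends s y) -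
        prob p (connEvent ends s v) * prob p (connEvent ends s y)) *
      prob p (connEvent ends s o ∩ (connEvent ends s y)ᶜ)

omit [Fintype V] [DecidableEq V] [LinearOrder R] [IsStrictOrderedRing R] in
/-- The complement masses of `tri` (`prob_inter_add_prob_inter_compl`, `prob_compl`). -/
private lemma masses (s o v y : V) :
    prob p (connEvent ends s o ∩ connEvent ends s y ∩ (connEvent ends s v)ᶜ) =
        prob p (connEvent ends s o ∩ (connEvent ends s v)ᶜ) -
          prob p (connEvent ends s o ∩ ((connEvent ends s v)ᶜ ∩ (connEvent ends s y)ᶜ)) ∧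
      prob p (connEvent ends s v ∩ connEvent ends s y) -
          prob p (connEvent ends s v) * prob p (connEvent ends s y) =
        prob p ((connEvent ends s v)ᶜ ∩ (connEvent ends s y)ᶜ) -
          prob p (connEvent ends s v)ᶜ * prob p (connEvent ends s y)ᶜ ∧
      prob p (connEvent ends s v)ᶜ = 1 - prob p (connEvent ends s v) ∧
      prob p (connEvent ends s y)ᶜ = 1 - prob p (connEvent ends s y) := by
  refine ⟨?_, ?_, prob_compl p _, prob_compl p _⟩
  · have h := prob_inter_add_prob_inter_compl p (connEvent ends s o ∩ (connEvent ends s v)ᶜ)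
      (connEvent ends s y)
    have e1 : connEvent ends s o ∩ (connEvent ends s v)ᶜ ∩ connEvent ends s y =
        connEvent ends s o ∩ connEvent ends s y ∩ (connEvent ends s v)ᶜ := by
      rw [Set.inter_right_comm]
    have e2 : connEvent ends s o ∩ (connEvent ends s v)ᶜ ∩ (connEvent ends s y)ᶜ =
        connEvent ends s o ∩ ((connEvent ends s v)ᶜ ∩ (connEvent ends s y)ᶜ) := by
      rw [Set.inter_assoc]
    rw [e1, e2] at h
    linear_combination h
  · have hVc := prob_inter_add_prob_inter_compl p (connEvent ends s v)ᶜ (connEvent ends s y)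
    have hY := prob_inter_add_prob_inter_compl p (connEvent ends s y) (connEvent ends s v)
    have hcv := prob_compl p (connEvent ends s v)
    have hcy := prob_compl p (connEvent ends s y)
    have e3 : (connEvent ends s v)ᶜ ∩ connEvent ends s y =
        connEvent ends s y ∩ (connEvent ends s v)ᶜ := by
      rw [Set.inter_comm]
    have e4 : connEvent ends s y ∩ connEvent ends s v = connEvent ends s v ∩ connEvent ends s y := by
      rw [Set.inter_comm]
    rw [e3] at hVc
    rw [e4] at hY
    linear_combination (-1 : R) * hVc + hY + (prob p (connEvent ends s y)ᶜ - 1) * hcv +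
      (1 - prob p (connEvent ends s v)) * hcy

omit [Fintype V] [DecidableEq V] [LinearOrder R] [IsStrictOrderedRing R] in
/-- **Identity for the case `Δ′ ≥ 0`**:
`tri = Δ′·P(Yᶜ) + [P(Vᶜ∩Yᶜ)·P(O∩Yᶜ) − P(O∩Vᶜ∩Yᶜ)·P(Yᶜ)]`, `Δ′ = P(O∩Vᶜ)·P(Yᶜ) − P(O∩Yᶜ)·P(Vᶜ)`. -/
theorem tri_eq_case_pos (s o v y : V) :
    tri p ends s o v y =
      (prob p (connEvent ends s o ∩ (connEvent ends s v)ᶜ) * prob p (connEvent ends s y)ᶜ -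
          prob p (connEvent ends s o ∩ (connEvent ends s y)ᶜ) * prob p (connEvent ends s v)ᶜ) *
        prob p (connEvent ends s y)ᶜ +
      (prob p ((connEvent ends s v)ᶜ ∩ (connEvent ends s y)ᶜ) *
          prob p (connEvent ends s o ∩ (connEvent ends s y)ᶜ) -
        prob p (connEvent ends s o ∩ ((connEvent ends s v)ᶜ ∩ (connEvent ends s y)ᶜ)) *
          prob p (connEvent ends s y)ᶜ) := by
  obtain ⟨h1, h2, h3, h4⟩ := masses p ends s o v y
  unfold tri
  rw [h1, h2, h3, h4]
  ring

omit [Fintype V] [DecidableEq V] [LinearOrder R] [IsStrictOrderedRing R] in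
/-- **Identity for the case `Δ′ < 0`**:
`tri·P(Vᶜ) = P(Yᶜ)·[P(Vᶜ∩Yᶜ)·P(O∩Vᶜ) − P(O∩Vᶜ∩Yᶜ)·P(Vᶜ)] − Cov(1_v, 1_y)·Δ′`. -/
theorem tri_mul_eq_case_neg (s o v y : V) :
    tri p ends s o v y * prob p (connEvent ends s v)ᶜ =
      prob p (connEvent ends s y)ᶜ *
          (prob p ((connEvent ends s v)ᶜ ∩ (connEvent ends s y)ᶜ) *
              prob p (connEvent ends s o ∩ (connEvent ends s v)ᶜ) -
            prob p (connEvent ends s o ∩ ((connEvent ends s v)ᶜ ∩ (connEvent ends s y)ᶜ)) *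
              prob p (connEvent ends s v)ᶜ) -
        (prob p (connEvent ends s v ∩ connEvent ends s y) -
            prob p (connEvent ends s v) * prob p (connEvent ends s y)) *
          (prob p (connEvent ends s o ∩ (connEvent ends s v)ᶜ) * prob p (connEvent ends s y)ᶜ -
            prob p (connEvent ends s o ∩ (connEvent ends s y)ᶜ) * prob p (connEvent ends s v)ᶜ) := by
  obtain ⟨h1, h2, h3, h4⟩ := masses p ends s o v y
  unfold tri
  rw [h1, h2, h3, h4]
  ring

/-- **The three-mark inequality**: `0 ≤ tri(s; o, v, y)`. -/
theorem tri_nonneg (hp : IsProbVec p) (s o v y : V) : 0 ≤ tri p ends s o v y := by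
  have hv := avoid_mono_v p ends hp s o v y
  have hy := avoid_mono_y p ends hp s o v y
  have hcov := prob_mul_prob_le_prob_inter hp (isUpperSet_connEvent ends s v)
    (isUpperSet_connEvent ends s y)
  have hYc := prob_nonneg hp (connEvent ends s y)ᶜ
  have hVc := prob_nonneg hp (connEvent ends s v)ᶜ
  set Δ' := prob p (connEvent ends s o ∩ (connEvent ends s v)ᶜ) * prob p (connEvent ends s y)ᶜ -
    prob p (connEvent ends s o ∩ (connEvent ends s y)ᶜ) * prob p (connEvent ends s v)ᶜ with hΔ
  rcases le_or_gt 0 Δ' with hpos | hneg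
  · rw [tri_eq_case_pos]
    have : 0 ≤ Δ' * prob p (connEvent ends s y)ᶜ := mul_nonneg hpos hYc
    linarith
  · -- `Δ′ < 0` forces `P(Vᶜ) > 0`
    have hVpos : 0 < prob p (connEvent ends s v)ᶜ := by
      rcases hVc.lt_or_eq with h | h
      · exact h
      · exfalso
        have hOV : prob p (connEvent ends s o ∩ (connEvent ends s v)ᶜ) = 0 :=
          le_antisymm (by
            calc prob p (connEvent ends s o ∩ (connEvent ends s v)ᶜ)
                ≤ prob p (connEvent ends s v)ᶜ := prob_inter_le_right hp _ _
              _ = 0 := h.symm) (prob_nonneg hp _)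
        rw [hΔ, hOV, ← h] at hneg
        simp at hneg
    have hmul : 0 ≤ tri p ends s o v y * prob p (connEvent ends s v)ᶜ := by
      rw [tri_mul_eq_case_neg]
      have h1 : 0 ≤ prob p (connEvent ends s y)ᶜ *
          (prob p ((connEvent ends s v)ᶜ ∩ (connEvent ends s y)ᶜ) *
              prob p (connEvent ends s o ∩ (connEvent ends s v)ᶜ) -
            prob p (connEvent ends s o ∩ ((connEvent ends s v)ᶜ ∩ (connEvent ends s y)ᶜ)) *
              prob p (connEvent ends s v)ᶜ) := mul_nonneg hYc (by linarith)
      have h2 : 0 ≤ (prob p (connEvent ends s v ∩ connEvent ends s y) -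
          prob p (connEvent ends s v) * prob p (connEvent ends s y)) * (-Δ') :=
        mul_nonneg (sub_nonneg.2 hcov) (by linarith)
      linarith
    exact le_of_mul_le_mul_right (by rw [zero_mul]; exact hmul) hVpos

end ClusterThreeMark

end Summit.Ventures.PercRepro2
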